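import Summits.Ventures.QEC.Census.CertChunks
import Summits.Ventures.QEC.Census.HB.HB120w6.Cert
import HarnessLib

/-!
# `HB120w6` — KERNEL-tier lower-bound replay, side Z, leaf file 1/1 (emitted by qec-search-7)

Bruteforce replay (CERT-FORMAT v1 §5.1, lemma L3) of the certificate `c860dab57ddebd4a`: every Z-type operator of weight
`1 … 3` has nonzero syndrome (rows `cert.HX`) or is allow-listed (allow-list []). This file holds
2 packed chunk evaluations (`chunk1R`/`chunk2R` of `Census/CertChunks.lean` over `posList 120 cert.HX`), total
288100 scan end points, each closed by `decide +kernel` — tier KERNEL (CERTIFIED): axioms ⊆ {propext, Classical.choice,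
Quot.sound}. Assembled in `HB/HB120w6/KernelZ.lean`. Do not edit; re-emit (HOME/census/search-7/emit_kernel.py).
-/

namespace Summit.Ventures.QEC.Census.HB120w6

/-- Level-1 chunks `i`, `0 ≤ i < 39`, side Z of `HB120w6` (199459 end points): pass. -/
theorem kZ1_0 : chunk1R (leafTest []) (posList 120 cert.HX) 2 0 39 = true := by decide +kernel

/-- Level-1 chunks `i`, `39 ≤ i < 120`, side Z of `HB120w6` (88641 end points): pass. -/
theorem kZ1_39 : chunk1R (leafTest []) (posList 120 cert.HX) 2 39 81 = true := by decide +kernel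

end Summit.Ventures.QEC.Census.HB120w6
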